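import Mathlib

/-!
# Matchings imply the joint-pool two-type inequality (JP)

Abstract double-counting lemma behind the two-type step of the Kozma–Nitzan Question 8
('coefficientwise') programme.  On a finite preordered type `X` let `D1, B2` be the exclusive
source sets of the two types, `T1, T2` their target sets and `P` the pool.  Suppose each type has
an increasing injection of its sources into its targets (`φ₁ : D1 → T1`, `φ₂ : B2 → T2`,
`y ≤ φᵢ y`), and that the *collisions* — targets hit by both matchings — can be sent injectively
into the pool by a map `ψ` lying above both colliding sources.  Then for **all** upper sets
`A, C` simultaneously

  `#(A ∩ D1) + #(C ∩ B2) ≤ #((A ∩ T1) ∪ (C ∩ T2)) + #(A ∩ C ∩ P)`,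

which is the joint-pool inequality JP (and hence the two-type inequality (X2) of the bouquet
reduction).  The point of the lemma is that matchings are *adaptive* certificates: on the plain
Boolean lattice (no cycle constraint) any two Kleitman matchings satisfy the hypotheses with
`ψ = id`, although no uniform linear certificate for the corresponding inductive step exists.
-/

namespace Summit.CriticalPhenomena.PercolationContinuityZ3.Theorems.Coefficientwise.JoinMatching

open Finset

variable {X : Type*} [DecidableEq X] [Preorder X]

/-- **Matchings imply JP.**  Two increasing injections of the exclusive sources into their own
targets, whose collisions inject into the pool above both colliding sources, give the joint-pool
inequality for every pair of upper sets. -/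
theorem jp_of_matchings (D1 B2 T1 T2 P : Finset X) (φ₁ φ₂ ψ : X → X)
    (h₁ : ∀ y ∈ D1, y ≤ φ₁ y ∧ φ₁ y ∈ T1) (h₁inj : Set.InjOn φ₁ (D1 : Set X))
    (h₂ : ∀ y ∈ B2, y ≤ φ₂ y ∧ φ₂ y ∈ T2) (h₂inj : Set.InjOn φ₂ (B2 : Set X))
    (hψ : ∀ y₁ ∈ D1, ∀ y₂ ∈ B2, φ₁ y₁ = φ₂ y₂ →
      y₁ ≤ ψ (φ₁ y₁) ∧ y₂ ≤ ψ (φ₁ y₁) ∧ ψ (φ₁ y₁) ∈ P)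
    (hψinj : Set.InjOn ψ ((D1.image φ₁ ∩ B2.image φ₂ : Finset X) : Set X))
    (A C : Finset X) (hA : IsUpperSet (A : Set X)) (hC : IsUpperSet (C : Set X)) :
    (A ∩ D1).card + (C ∩ B2).card ≤ ((A ∩ T1) ∪ (C ∩ T2)).card + (A ∩ C ∩ P).card := by
  classical
  -- the two image sets
  set I₁ : Finset X := (A ∩ D1).image φ₁ with hI₁
  set I₂ : Finset X := (C ∩ B2).image φ₂ with hI₂
  have hc₁ : I₁.card = (A ∩ D1).card :=
    card_image_of_injOn (h₁inj.mono (by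
      intro y hy; exact (mem_inter.mp (mem_coe.mp hy)).2))
  have hc₂ : I₂.card = (C ∩ B2).card :=
    card_image_of_injOn (h₂inj.mono (by
      intro y hy; exact (mem_inter.mp (mem_coe.mp hy)).2))
  -- the union of the images lies in the union of the typed targets
  have hU : I₁ ∪ I₂ ⊆ (A ∩ T1) ∪ (C ∩ T2) := by
    intro t ht
    rcases mem_union.mp ht with ht | ht
    · obtain ⟨y, hy, rfl⟩ := mem_image.mp ht
      obtain ⟨hyA, hyD⟩ := mem_inter.mp hy
      obtain ⟨hle, hT⟩ := h₁ y hyD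
      exact mem_union_left _ (mem_inter.mpr ⟨mem_coe.mp (hA hle (mem_coe.mpr hyA)), hT⟩)
    · obtain ⟨y, hy, rfl⟩ := mem_image.mp ht
      obtain ⟨hyC, hyB⟩ := mem_inter.mp hy
      obtain ⟨hle, hT⟩ := h₂ y hyB
      exact mem_union_right _ (mem_inter.mpr ⟨mem_coe.mp (hC hle (mem_coe.mpr hyC)), hT⟩)
  -- the intersection of the images injects into the joint pool
  have hIsub : I₁ ∩ I₂ ⊆ D1.image φ₁ ∩ B2.image φ₂ := by
    intro t ht
    obtain ⟨ht₁, ht₂⟩ := mem_inter.mp ht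
    refine mem_inter.mpr ⟨?_, ?_⟩
    · exact image_subset_image (inter_subset_right) ht₁
    · exact image_subset_image (inter_subset_right) ht₂
  have hψI : (I₁ ∩ I₂).image ψ ⊆ A ∩ C ∩ P := by
    intro p hp
    obtain ⟨t, ht, rfl⟩ := mem_image.mp hp
    obtain ⟨ht₁, ht₂⟩ := mem_inter.mp ht
    obtain ⟨y₁, hy₁, h₁t⟩ := mem_image.mp ht₁
    obtain ⟨y₂, hy₂, h₂t⟩ := mem_image.mp ht₂
    obtain ⟨hy₁A, hy₁D⟩ := mem_inter.mp hy₁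
    obtain ⟨hy₂C, hy₂B⟩ := mem_inter.mp hy₂
    have heq : φ₁ y₁ = φ₂ y₂ := by rw [h₁t, h₂t]
    obtain ⟨hle₁, hle₂, hP⟩ := hψ y₁ hy₁D y₂ hy₂B heq
    rw [h₁t] at hle₁ hle₂ hP
    refine mem_inter.mpr ⟨mem_inter.mpr ⟨?_, ?_⟩, hP⟩
    · exact mem_coe.mp (hA hle₁ (mem_coe.mpr hy₁A))
    · exact mem_coe.mp (hC hle₂ (mem_coe.mpr hy₂C))
  have hcI : (I₁ ∩ I₂).card ≤ (A ∩ C ∩ P).card := by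
    calc (I₁ ∩ I₂).card = ((I₁ ∩ I₂).image ψ).card :=
          (card_image_of_injOn (hψinj.mono (by
            intro t ht; exact mem_coe.mpr (hIsub (mem_coe.mp ht))))).symm
      _ ≤ (A ∩ C ∩ P).card := card_le_card hψI
  have hie : (I₁ ∪ I₂).card + (I₁ ∩ I₂).card = I₁.card + I₂.card := card_union_add_card_inter I₁ I₂
  have hUc : (I₁ ∪ I₂).card ≤ ((A ∩ T1) ∪ (C ∩ T2)).card := card_le_card hU
  omega

/-- The collision-free special case: if the two matchings never hit a common target outside the
pool `P` — e.g. on the plain Boolean lattice, where every common target of two *exclusive*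
sources is automatically a pool point — then `ψ = id` works. -/
theorem jp_of_matchings_id (D1 B2 T1 T2 P : Finset X) (φ₁ φ₂ : X → X)
    (h₁ : ∀ y ∈ D1, y ≤ φ₁ y ∧ φ₁ y ∈ T1) (h₁inj : Set.InjOn φ₁ (D1 : Set X))
    (h₂ : ∀ y ∈ B2, y ≤ φ₂ y ∧ φ₂ y ∈ T2) (h₂inj : Set.InjOn φ₂ (B2 : Set X))
    (hP : ∀ y₁ ∈ D1, ∀ y₂ ∈ B2, φ₁ y₁ = φ₂ y₂ → φ₁ y₁ ∈ P)
    (A C : Finset X) (hA : IsUpperSet (A : Set X)) (hC : IsUpperSet (C : Set X)) :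
    (A ∩ D1).card + (C ∩ B2).card ≤ ((A ∩ T1) ∪ (C ∩ T2)).card + (A ∩ C ∩ P).card := by
  refine jp_of_matchings D1 B2 T1 T2 P φ₁ φ₂ id h₁ h₁inj h₂ h₂inj ?_ ?_ A C hA hC
  · intro y₁ hy₁ y₂ hy₂ heq
    refine ⟨(h₁ y₁ hy₁).1, ?_, hP y₁ hy₁ y₂ hy₂ heq⟩
    simpa [heq] using (h₂ y₂ hy₂).1
  · exact Set.injOn_id _

omit [Preorder X] in
/-- **JP implies (X2).**  The joint-pool inequality with its union right-hand side dominates the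
original two-type inequality (X2) of the bouquet reduction (exclusive sources and exclusive
targets on `A \ C`, `C \ A`, an `NE`-pool and a `P`-pool on `A ∩ C`), provided the typed targets
lie in `NE`.  Pure counting: the (X2) sources are among the JP sources, and the union of typed
targets splits into exclusive targets and joint `NE` points. -/
theorem x2_of_jp (A C D1 B2 T1 T2 NE P : Finset X) (hT1 : T1 ⊆ NE) (hT2 : T2 ⊆ NE)
    (hJP : (A ∩ D1).card + (C ∩ B2).card ≤ ((A ∩ T1) ∪ (C ∩ T2)).card + (A ∩ C ∩ P).card) :
    ((A \ C) ∩ D1).card + ((C \ A) ∩ B2).card ≤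
      ((A \ C) ∩ T1).card + ((C \ A) ∩ T2).card + (A ∩ C ∩ NE).card + (A ∩ C ∩ P).card := by
  have hs₁ : ((A \ C) ∩ D1).card ≤ (A ∩ D1).card :=
    card_le_card (inter_subset_inter_right (sdiff_subset))
  have hs₂ : ((C \ A) ∩ B2).card ≤ (C ∩ B2).card :=
    card_le_card (inter_subset_inter_right (sdiff_subset))
  have hsub : (A ∩ T1) ∪ (C ∩ T2) ⊆ (((A \ C) ∩ T1) ∪ ((C \ A) ∩ T2)) ∪ (A ∩ C ∩ NE) := by
    intro t ht
    rcases mem_union.mp ht with h | h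
    · obtain ⟨hA, hT⟩ := mem_inter.mp h
      by_cases hC : t ∈ C
      · exact mem_union_right _ (mem_inter.mpr ⟨mem_inter.mpr ⟨hA, hC⟩, hT1 hT⟩)
      · exact mem_union_left _ (mem_union_left _ (mem_inter.mpr ⟨mem_sdiff.mpr ⟨hA, hC⟩, hT⟩))
    · obtain ⟨hC, hT⟩ := mem_inter.mp h
      by_cases hA : t ∈ A
      · exact mem_union_right _ (mem_inter.mpr ⟨mem_inter.mpr ⟨hA, hC⟩, hT2 hT⟩)
      · exact mem_union_left _ (mem_union_right _ (mem_inter.mpr ⟨mem_sdiff.mpr ⟨hC, hA⟩, hT⟩))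
  have hU : ((A ∩ T1) ∪ (C ∩ T2)).card ≤
      ((A \ C) ∩ T1).card + ((C \ A) ∩ T2).card + (A ∩ C ∩ NE).card :=
    calc ((A ∩ T1) ∪ (C ∩ T2)).card
        ≤ ((((A \ C) ∩ T1) ∪ ((C \ A) ∩ T2)) ∪ (A ∩ C ∩ NE)).card := card_le_card hsub
      _ ≤ (((A \ C) ∩ T1) ∪ ((C \ A) ∩ T2)).card + (A ∩ C ∩ NE).card := card_union_le _ _
      _ ≤ ((A \ C) ∩ T1).card + ((C \ A) ∩ T2).card + (A ∩ C ∩ NE).card :=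
          Nat.add_le_add_right (card_union_le _ _) _
  omega

/-- **Matchings imply (X2)**, all upper sets at once: the composition of `jp_of_matchings` and
`x2_of_jp`. -/
theorem x2_of_matchings (D1 B2 T1 T2 NE P : Finset X) (hT1 : T1 ⊆ NE) (hT2 : T2 ⊆ NE)
    (φ₁ φ₂ ψ : X → X)
    (h₁ : ∀ y ∈ D1, y ≤ φ₁ y ∧ φ₁ y ∈ T1) (h₁inj : Set.InjOn φ₁ (D1 : Set X))
    (h₂ : ∀ y ∈ B2, y ≤ φ₂ y ∧ φ₂ y ∈ T2) (h₂inj : Set.InjOn φ₂ (B2 : Set X))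
    (hψ : ∀ y₁ ∈ D1, ∀ y₂ ∈ B2, φ₁ y₁ = φ₂ y₂ →
      y₁ ≤ ψ (φ₁ y₁) ∧ y₂ ≤ ψ (φ₁ y₁) ∧ ψ (φ₁ y₁) ∈ P)
    (hψinj : Set.InjOn ψ ((D1.image φ₁ ∩ B2.image φ₂ : Finset X) : Set X))
    (A C : Finset X) (hA : IsUpperSet (A : Set X)) (hC : IsUpperSet (C : Set X)) :
    ((A \ C) ∩ D1).card + ((C \ A) ∩ B2).card ≤
      ((A \ C) ∩ T1).card + ((C \ A) ∩ T2).card + (A ∩ C ∩ NE).card + (A ∩ C ∩ P).card :=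
  x2_of_jp A C D1 B2 T1 T2 NE P hT1 hT2
    (jp_of_matchings D1 B2 T1 T2 P φ₁ φ₂ ψ h₁ h₁inj h₂ h₂inj hψ hψinj A C hA hC)

section Kleitman

variable [Fintype X] [DecidableRel (α := X) (· ≤ ·)]

/-- **Kleitman–Hall.**  If `#(U ∩ W) ≤ #{x ∈ U | c x ∈ W}` for every upper family `U`
(Kleitman's inequality for the lower family `W` and the complement-type map `c`), then every
`S ⊆ W` has an increasing injection into the mirror `{t | c t ∈ W}` of `W`. -/
theorem exists_increasing_injection (c : X → X) (W S : Finset X) (hS : S ⊆ W)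
    (hK : ∀ U : Finset X, IsUpperSet (U : Set X) →
      (U ∩ W).card ≤ (U.filter (fun x => c x ∈ W)).card) :
    ∃ φ : X → X, Set.InjOn φ (S : Set X) ∧ ∀ y ∈ S, y ≤ φ y ∧ c (φ y) ∈ W := by
  classical
  -- Hall's marriage theorem for the relation `y ↦ {t | y ≤ t ∧ c t ∈ W}` on the subtype of `S`
  let t : S → Finset X := fun y => univ.filter (fun x => (y : X) ≤ x ∧ c x ∈ W)
  have hHall : ∀ s : Finset S, s.card ≤ (s.biUnion t).card := by
    intro s
    -- U := upper closure of the image of s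
    set S' : Finset X := s.image (fun y : S => (y : X)) with hS'
    have hcard : s.card = S'.card := by
      rw [hS', card_image_of_injective _ Subtype.val_injective]
    -- U := the upper closure of S'
    set U : Finset X := univ.filter (fun x => ∃ y ∈ S', y ≤ x) with hU
    have hmemU : ∀ {x : X}, x ∈ U ↔ ∃ y ∈ S', y ≤ x := by
      intro x; simp [hU]
    have hUup : IsUpperSet (U : Set X) := by
      intro a b hab ha
      obtain ⟨y, hy, hya⟩ := hmemU.mp (mem_coe.mp ha)
      exact mem_coe.mpr (hmemU.mpr ⟨y, hy, le_trans hya hab⟩)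
    have hS'U : S' ⊆ U ∩ W := by
      intro y hy
      refine mem_inter.mpr ⟨hmemU.mpr ⟨y, hy, le_rfl⟩, ?_⟩
      obtain ⟨y', _, rfl⟩ := mem_image.mp hy
      exact hS y'.2
    have hsub : U.filter (fun x => c x ∈ W) ⊆ s.biUnion t := by
      intro x hx
      obtain ⟨hxU, hcx⟩ := mem_filter.mp hx
      obtain ⟨y, hy, hyx⟩ := hmemU.mp hxU
      obtain ⟨y', hy', rfl⟩ := mem_image.mp hy
      exact mem_biUnion.mpr ⟨y', hy', mem_filter.mpr ⟨mem_univ _, hyx, hcx⟩⟩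
    calc s.card = S'.card := hcard
      _ ≤ (U ∩ W).card := card_le_card hS'U
      _ ≤ (U.filter (fun x => c x ∈ W)).card := hK U hUup
      _ ≤ (s.biUnion t).card := card_le_card hsub
  obtain ⟨f, hfinj, hft⟩ := (all_card_le_biUnion_card_iff_exists_injective t).1 hHall
  refine ⟨fun x => if h : x ∈ S then f ⟨x, h⟩ else x, ?_, ?_⟩
  · intro a ha b hb hab
    have ha' : a ∈ S := mem_coe.mp ha
    have hb' : b ∈ S := mem_coe.mp hb
    simp only [ha', hb', dif_pos] at hab
    have := hfinj hab
    exact congrArg Subtype.val this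
  · intro y hy
    have hmem := hft ⟨y, hy⟩
    simp only [hy, dif_pos]
    exact ⟨(mem_filter.mp hmem).2.1, (mem_filter.mp hmem).2.2⟩

/-- **JP on a Kleitman space with no cycle constraint.**  If Kleitman's inequality holds for the
lower families `D` and `B` (e.g. on any finite Boolean lattice, for all lower families), then the
joint-pool inequality JP holds for all upper `A, C`, with typed targets the mirrors of the levels
and the pool the complement of `D ∪ B`: the two Kleitman matchings never collide inside `D ∪ B`.
This is the 'pendant edges only' case of the two-type inequality. -/
theorem jp_of_kleitman (c : X → X) (D B : Finset X)
    (hDlow : IsLowerSet (D : Set X)) (hBlow : IsLowerSet (B : Set X))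
    (hKD : ∀ U : Finset X, IsUpperSet (U : Set X) →
      (U ∩ D).card ≤ (U.filter (fun x => c x ∈ D)).card)
    (hKB : ∀ U : Finset X, IsUpperSet (U : Set X) →
      (U ∩ B).card ≤ (U.filter (fun x => c x ∈ B)).card)
    (A C : Finset X) (hA : IsUpperSet (A : Set X)) (hC : IsUpperSet (C : Set X)) :
    (A ∩ (D \ B)).card + (C ∩ (B \ D)).card ≤
      ((A ∩ univ.filter (fun x => c x ∈ D)) ∪ (C ∩ univ.filter (fun x => c x ∈ B))).card +
        (A ∩ C ∩ (univ \ (D ∪ B))).card := by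
  classical
  obtain ⟨φ₁, h₁inj, h₁⟩ := exists_increasing_injection c D (D \ B) sdiff_subset hKD
  obtain ⟨φ₂, h₂inj, h₂⟩ := exists_increasing_injection c B (B \ D) sdiff_subset hKB
  refine jp_of_matchings_id (D \ B) (B \ D) (univ.filter (fun x => c x ∈ D))
    (univ.filter (fun x => c x ∈ B)) (univ \ (D ∪ B)) φ₁ φ₂ ?_ h₁inj ?_ h₂inj ?_ A C hA hC
  · intro y hy
    exact ⟨(h₁ y hy).1, mem_filter.mpr ⟨mem_univ _, (h₁ y hy).2⟩⟩
  · intro y hy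
    exact ⟨(h₂ y hy).1, mem_filter.mpr ⟨mem_univ _, (h₂ y hy).2⟩⟩
  · intro y₁ hy₁ y₂ hy₂ heq
    refine mem_sdiff.mpr ⟨mem_univ _, ?_⟩
    intro hmem
    rcases mem_union.mp hmem with hD | hB
    · -- φ₁ y₁ = φ₂ y₂ ≥ y₂ ∉ D, contradiction with D lower
      have hle : y₂ ≤ φ₂ y₂ := (h₂ y₂ hy₂).1
      rw [← heq] at hle
      exact (mem_sdiff.mp hy₂).2 (mem_coe.mp (hDlow hle (mem_coe.mpr hD)))
    · have hle : y₁ ≤ φ₁ y₁ := (h₁ y₁ hy₁).1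
      exact (mem_sdiff.mp hy₁).2 (mem_coe.mp (hBlow hle (mem_coe.mpr hB)))

end Kleitman

section BooleanLattice

variable {α : Type*} [Fintype α] [DecidableEq α]

/-- **Kleitman's inequality in mirror form** on the Boolean lattice `Finset α`: for an upper
family `U` and a lower family `W`, `#(U ∩ W) ≤ #{x ∈ U | xᶜ ∈ W}` — Harris for `U` and the
mirror of `W` combined with Kleitman for `U` and `W` (both from Mathlib's Harris–Kleitman). -/
theorem kleitman_mirror (U W : Finset (Finset α)) (hU : IsUpperSet (U : Set (Finset α)))
    (hW : IsLowerSet (W : Set (Finset α))) :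
    (U ∩ W).card ≤ (U.filter (fun x => xᶜ ∈ W)).card := by
  classical
  set W' : Finset (Finset α) := univ.filter (fun x => xᶜ ∈ W) with hW'
  have hmem : ∀ {x : Finset α}, x ∈ W' ↔ xᶜ ∈ W := by intro x; simp [hW']
  have hW'up : IsUpperSet (W' : Set (Finset α)) := by
    intro a b hab ha
    have ha' : aᶜ ∈ W := hmem.mp (mem_coe.mp ha)
    exact mem_coe.mpr (hmem.mpr (hW (compl_le_compl hab) ha'))
  have hcard : W'.card = W.card := by
    have : W' = W.map ⟨compl, compl_injective⟩ := by
      ext x; constructor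
      · intro hx
        exact mem_map.mpr ⟨xᶜ, hmem.mp hx, by simp⟩
      · intro hx
        obtain ⟨y, hy, rfl⟩ := mem_map.mp hx
        exact hmem.mpr (by simpa using hy)
    rw [this, card_map]
  have hfilt : U.filter (fun x => xᶜ ∈ W) = U ∩ W' := by
    ext x; simp [hW', mem_inter]
  rw [hfilt]
  have h1 : 2 ^ Fintype.card α * (U ∩ W).card ≤ U.card * W.card :=
    IsUpperSet.card_inter_le_finset hU hW
  have h2 : U.card * W'.card ≤ 2 ^ Fintype.card α * (U ∩ W').card :=
    IsUpperSet.le_card_inter_finset hU hW'up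
  rw [hcard] at h2
  have hpos : 0 < 2 ^ Fintype.card α := by positivity
  exact Nat.le_of_mul_le_mul_left (le_trans h1 h2) hpos

/-- **JP on the Boolean lattice (the 'pendant edges only' case of the two-type theorem).**
For ALL lower families `D, B` and ALL upper families `A, C` of subsets of a finite set,
with typed targets the mirrors `{x | xᶜ ∈ D}`, `{x | xᶜ ∈ B}` and pool the complement of `D ∪ B`:

  `#(A ∩ (D \ B)) + #(C ∩ (B \ D)) ≤ #((A ∩ {xᶜ ∈ D}) ∪ (C ∩ {xᶜ ∈ B})) + #(A ∩ C ∩ (D ∪ B)ᶜ)`.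

No linear (pointwise) certificate for the corresponding one-coordinate induction step exists;
the proof is two Kleitman matchings (`jp_of_kleitman`). -/
theorem jp_booleanLattice (D B A C : Finset (Finset α))
    (hD : IsLowerSet (D : Set (Finset α))) (hB : IsLowerSet (B : Set (Finset α)))
    (hA : IsUpperSet (A : Set (Finset α))) (hC : IsUpperSet (C : Set (Finset α))) :
    (A ∩ (D \ B)).card + (C ∩ (B \ D)).card ≤
      ((A ∩ univ.filter (fun x => xᶜ ∈ D)) ∪ (C ∩ univ.filter (fun x => xᶜ ∈ B))).card +
        (A ∩ C ∩ (univ \ (D ∪ B))).card :=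
  jp_of_kleitman compl D B hD hB (fun U hU => kleitman_mirror U D hU hD)
    (fun U hU => kleitman_mirror U B hU hB) A C hA hC

end BooleanLattice

end Summit.CriticalPhenomena.PercolationContinuityZ3.Theorems.Coefficientwise.JoinMatching
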